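import Summits.BirchSwinnertonDyer.Rank1Residual.O5.HeegnerLogTransportThreeBSDp
import Literature.NumberTheory.EllipticCurves.ManinConstantConductorLe300000
import Literature.NumberTheory.EllipticCurves.ManinConstantSemistablePrimewise
import Literature.NumberTheory.EllipticCurves.CuspFormLFunctionLevelConductorProofs
import Literature.NumberTheory.EllipticCurves.Wuthrich2014.ThreeAdicImageSupersingularProofs
import Literature.NumberTheory.EllipticCurves.AnalyticRankModularityProofs
import Summits.BirchSwinnertonDyer.Rank1Residual.O5.HeegnerHypothesisOfDiscr
import HarnessLib
import HarnessLib.Audit.Tags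

/-!
# Heegner-log transport at `p = 3` (KL3), part 35a (= part 34a with the companion's Manin binder discharged from MAZUR 1978
# Cor. 4.1 BY NAME and the A321 provenance flags carried) — the row of record
# `240930b1` in closing currency with BOTH Manin binders AND Wuthrich's Lemma 20 discharged BY NAME, `hmodE` derived,
# the Heegner hypotheses derived in the kernel
# (o5-r2 GEN 33 docket (iii) of `gen32/O5-GEN32.md` §G32-7; o5-r2 GEN 34; o5-r2 GEN 35)

HONEST FRAMING (cell `b2b-bsdres`, run/shared/lean/b2b/bsd-rank1-residual/, verbatim in every file): the
goal of the cell is to DELETE the COMBINATION-SHAPED residual classes of the Birch–Swinnerton-Dyer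
formula for ALL analytic-rank `≤ 1` elliptic curves over `ℚ` — "full BSD formula for every rank `≤ 1`
curve in class `C`" assembled STRICTLY from published theorems — so that the rank-`≤ 1` remainder
becomes exactly the CONSTRUCTION-SHAPED classes, which are TYPED (missing-input `Prop`s), NOT
attempted. This is not "finishing BSD". Seat o5-r2 (planner 2, non-Iwasawa side) works a RESEARCH ROUTE
on O5 = (t′); **O5 stays OPEN**; no claim beyond the stated rows; every theorem is CONDITIONAL on its
displayed binders; census / instrument statements are EVIDENCE or displayed binders, never a Literature
fact; NOTHING is booked and no mark / label / count / tier of `RESIDUAL-MAP.md` moves.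

GEN 35 (this file SUPERSEDES the GEN 34 bytes of the same name; o5-r2 GEN 35, memo `HOME/b2b-bsdres-o5-r2/gen35/O5-GEN35.md`):
(1) MAZUR FOR THE COMPANION. The companion-side Manin binder `hc3' : ¬ 3 ∣ c(D')` of the good companion `26770a1` (`N_G = 26770 = 2·5·2677`: `3 ∤ N_G`) is discharged
BY NAME from the REFEREED theorem Mazur 1978, Cor. 4.1 = tree named fact `mazur_not_dvd_maninConstant_of_odd`
(`Literature/NumberTheory/EllipticCurves/ManinConstantSemistablePrimewise.lean`, librarian 2026-08-16, BUILT; Česnavičius 2018 Thm. 1.2 (MK-1),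
arXiv:1604.02165 p. 3; consumed likewise by X11b `BDPRouteManin`): globally minimal `G` (MODELS instance), optimal datum (`hopt'` = the fact's own
binder `Λ_E ⊆ c·Λ_f`), `p = 3 ≠ 2`, `¬ 3² ∣ N'` by Carayol (`N' = N_G` from `hmod`, kernel numeral `conductorNorm_G…`) + `norm_num` — NO range
bound, NO database primary, NO registry flag. New:
`o5_bsdp_row240930b1_mazur` = the same row with `hc3'` so discharged and the RECORD-side `hc3` DISPLAYED (`3² ∣ N_W`: outside Mazur) — flag-free;
`o5_bsdp_row240930b1_manin` now use Mazur on the companion side, A321 on the record side ONLY.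
(2) A321 PROVENANCE FLAGS CARRIED (referee A R199.5; REFEREE-2 R2-140.1; registry CITED-FACTS A321 = PUB[sec]): BOTH flags `CRE19-db-primary`
+ `CNS24-range-reading` travel with every displayed `hMan` — spelled out in each `_manin` docstring below; A321 is usable AS PRINTED at
`N ≤ 300000` only, and every A321 instantiation in this file is inside the range AND the narrow ČNS population:
`N(240930b1) = 240930 = 2·3²·5·2677` (odd additive prime `3`).
(3) The Heegner level lemma(s) `satisfiesHeegnerHypothesis_listProd_of_kronecker`, `satisfiesHeegnerHypothesis_240930_of_discr` (GEN 34 edit 3) MOVED, bytes unchanged, to part 35h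
`O5/HeegnerHypothesisOfDiscr.lean` (imported; dependency-free, farm-checked rc 0) — no row file imports another row file any more.
No other change of statement; §1/§2 byte-identical to GEN 34.

GEN 34 (superseded the GEN 33 bytes): the binder
`hW20 : Wuthrich2014.lemma20_surjective_threeAdic_of_semistable` (Wuthrich 2014, Lemma 20; registry CITED-FACTS A9)
is NO LONGER DISPLAYED — it is DISCHARGED BY NAME by the tree theorem
`Wuthrich2014.lemma20_surjective_threeAdic_of_semistable_holds`
(`Literature/NumberTheory/EllipticCurves/Wuthrich2014/ThreeAdicImageSupersingularProofs.lean`, landed 2026-08-21,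
built; A9 → DISCHARGED (PROVED), CITED-FACTS l.1094), exactly as the Additive lane's `…NoLemma20` files do.
Likewise `hmodE : hasEntireLFunction_rat` (A19) is NO LONGER DISPLAYED: it is DERIVED from `hmod` by the tree theorem
`WeierstrassCurve.hasEntireLFunction_rat_of_exists_isNewformOf` (`AnalyticRankModularityProofs.lean`, Diamond–Shurman
Thm 8.8.3 + 5.10.2), as the X11b Castella files do — the displayed modularity input is the single root fact `hmod`.
Third (GEN 34 edit 3): the Heegner-hypothesis binders `hH : SatisfiesHeegnerHypothesis N K`, `hH' : … N' K`,
`h3K : … 3 K` are NO LONGER DISPLAYED — they are DERIVED IN THE KERNEL: the decomposition law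
(`satisfiesHeegnerHypothesis_iff_kronecker`, tree, PROVED) + Jacobi symbols `(d_K/p) = 1` by `norm_num` for the primes of the
literal level (`satisfiesHeegnerHypothesis_<N>_of_discr`, part 35h), Carayol (`N = N_W`, `N' = N_G` from `hmod`, as for the Manin
discharge) and `SatisfiesHeegnerHypothesis.of_dvd` (`N_G ∣ N_W`, `3 ∣ N_W`). The remaining set-up binders
(`D`, `D'`, `K` with `hK`/`hdK`, `H`, `H'`, `ι`, `ι₃`, `P`, `P'` with `hP`/`hP'`) are pure DATA, each instantiable by a
tree theorem given `hmod` (see the GEN 34 binder census). No other change of statement.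

WHAT IS HERE. Part 32 §3 (`o5_bsdp_row240930b1 : … → BSDp 240930b1 3`, by-sha ask A-O5-G32-1) displays two
Manin binders `hc3 : ¬ 3 ∣ c(D)` (record `240930b1`, additive at `3`) and `hc3' : ¬ 3 ∣ c(D')` (good companion
`26770a1`). The literature seat (lit GEN 112, p368272 ACCEPTED b68e637a0b6f, answering this seat's ask
A-O5-G31-2) vendored `Literature/NumberTheory/EllipticCurves/ManinConstantConductorLe300000.lean`: the named fact
`cremona_abs_maninConstant_eq_one_of_level_le_300000` — Cremona's completed verification `|c| = 1` for every OPTIMAL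
parametrisation datum of conductor `≤ 300000`, as cited in print by Česnavičius–Neururer–Saha, JEMS 26 (2024) §1 —
with the corollary `not_dvd_maninConstant_of_level_le_300000`. Both levels here are in range: `N = N(240930b1) =
240930` and `N' = N(26770a1) = 26770`, each obtained from the datum's level by Carayol's level theorem IN THE TREE
(`IsNewformOf.level_eq_conductorNorm_of_exists_isNewformOf`, from the displayed modularity fact `hmod`) and the
kernel conductor numerals `conductorNorm_W240930b1`, `conductorNorm_G26770a1` of part 25c (`…TwoSidedRow240930b1`).
So `o5_bsdp_row240930b1_manin` replaces `hc3` by the named fact `hMan` (A321, record side, flags carried — GEN 35 (2)) and `hc3'` by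
Mazur's theorem `hMaz` BY NAME (GEN 35 (1)), with the OPTIMALITY of the two chosen
data (`hopt`, `hopt'` : `Λ_E ⊆ c·Λ_f` — the binder of `AgasheRibetStein2006.cremona_abs_maninConstant_eq_one_of_level_le`
word for word; a property of the CHOSEN datum, as for every consumer of the ARS2006 file). No Manin binder remains (`o5_bsdp_row240930b1_mazur`: only the companion's, flag-free, `hc3` displayed);
`hW20` is supplied to part 32's `o5_bsdp_row240930b1` by the tree theorem `…lemma20_surjective_threeAdic_of_semistable_holds`
and `hmodE` by `hasEntireLFunction_rat_of_exists_isNewformOf hmod`; `hH`, `hH'`, `h3K` are derived in the kernel (GEN 34 note).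
0 new defs, 0 Literature facts authored here (the fact is the literature seat's, consumed BY NAME), 0 sorry.

STATUS (GEN 33 / GEN 34 / GEN 35): NOT farm-checkable as a whole (GEN 35: part 32 still unplaced, the A321 module's olean still unbuilt;
the Mazur module IS built — probe rc 0 — and the GEN 35 §1 theorems were elaborated REAL in `gen35/scratch/BSDpMazur_composition_scratch.lean`,
`#print axioms` standard, see `gen35/scratch/CHECKS.md`). GEN 33/34 record: NOT farm-checkable as a whole — import `O5.HeegnerLogTransportThreeBSDp` (part 32) is not
yet placed and the Manin module's olean is in the farm backlog (`remote:stale:…:unbuilt` this GEN, 16:2x–16:5xZ); the corollary WAS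
elaborated in `gen33/scratch/BSDpManin_composition_scratch.lean` against part 32 §1+§3 copied verbatim with REAL
proofs (all their inputs built) and a verbatim local copy of the fact + corollary statements (rc recorded in
`gen33/scratch/CHECKS.md`; GEN 34: `gen34/scratch/BSDpNoLemma20_composition_scratch.lean`, `gen34/scratch/CHECKS.md`).
To be placed after part 32.

References: [Mazur1978] B. Mazur, Rational isogenies of prime degree, Invent. Math. 44 (1978), Cor. 4.1;
[Cesnavicius2018] K. Česnavičius, The Manin constant in the semistable case, Compositio Math. 154 (2018), Thm. 1.2 (MK-1);
[CesnaviciusNeururerSaha2023] K. Česnavičius, M. Neururer, A. Saha, The Manin constant and the modular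
degree, JEMS 26 (2024) 573–637, §1; [Cremona2022ManinConstants] `ecdata/manin.txt`; [AgasheRibetStein2006] Thm. 2.6;
[DiamondShurman2005] Thm. 8.8.1 (Carayol); and the references of part 32.

### cc-typer-5 GEN 20 (O5 §3.5 / O6 §3.4 typer of record) — by-name ask A-O5-G35-1 of o5-r2 GEN 35 (HOME/INBOX.md l.16133; by sha, VERBATIM + ¶; memo gen35/O5-GEN35.md §G35-6;
SUPERSEDES the A-O5-G33-1 / G34-1 versions) item (a) 49f1763b3591f372 → O5/HeegnerLogTransportThreeBSDpRow240930b1Manin.lean (after (h) + part 32). Source: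
`HOME/b2b-bsdres-o5-r2/gen35/lean/HeegnerLogTransportThreeBSDpRow240930b1Manin.lean` sha16 `49f1763b3591f372` (252 l.; `gen35/SHA16.txt`; o5-r2's farm checks rc 0 / 0 warnings /
0 sorries, axioms standard, dedup clean as stated in their line), re-hashed by the typer right before writing; THIS file = the source VERBATIM + this paragraph (imports, module
text, every declaration block byte-identical; script `class-closure/typer-5/gen20/gplace.py`, docstring anchor asserted); imports `O5.HeegnerLogTransportThreeBSDp`,
`Literature.NumberTheory.EllipticCurves.ManinConstantConductorLe300000`, `Literature.NumberTheory.EllipticCurves.ManinConstantSemistablePrimewise`,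
`Literature.NumberTheory.EllipticCurves.CuspFormLFunctionLevelConductorProofs`, `Literature.NumberTheory.EllipticCurves.Wuthrich2014.ThreeAdicImageSupersingularProofs`,
`Literature.NumberTheory.EllipticCurves.AnalyticRankModularityProofs`, `O5.HeegnerHypothesisOfDiscr` — all in the tree at filing; the typer's own standalone farm check on tree
imports (rc 0 / 0 warnings / 0 sorries; `#print axioms` of the END(s) standard) and DEDUP (`lean search --decl` on the 2 new names: no match; the gate's statement-level dedup at
dry-run) precede the proposal. CONTENT LABELS: as the source's module text above states (declarations: `o5_bsdp_row240930b1_manin`, `o5_bsdp_row240930b1_mazur`); 0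
`@[conjecture]`, 0 Literature facts (net named-fact debt 0), no `sorry`; published inputs stay displayed hypotheses BY NAME, nothing re-proved. HONEST FRAMING (cell
`b2b-bsdres`): research route, lane CLASS-CLOSURE §3.5 O5; CONDITIONAL ENDs — nothing asserted beyond the displayed binders, nothing booked, no mark / label / count / tier of
`RESIDUAL-MAP.md` moves; census / instrument statements = EVIDENCE or displayed binders, never a Literature fact; O5 OPEN.
-/

set_option autoImplicit false

noncomputable section

open scoped Classical

open WeierstrassCurve Literature.NumberTheory.EllipticCurves
  Literature.NumberTheory.EllipticCurves.ModularForms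
  Literature.NumberTheory.EllipticCurves.Rank1Residual
  Literature.NumberTheory.EllipticCurves.Rank1Residual.Typed
  Literature.NumberTheory.EllipticCurves.KrizLi2019
open IsDedekindDomain (HeightOneSpectrum)
open scoped NumberField

namespace Summit.BirchSwinnertonDyer.Rank1Residual.O5.HeegnerLogTransport

open KL3TwoSidedRows

/-! ## §1 `BSD(240930b1, 3)` with the Manin binders discharged BY NAME (record: A321, flags carried; companion: Mazur 1978) and the
flag-free Mazur-only variant (GEN 35; the Heegner level lemmas of GEN 34 moved to part 35h `O5/HeegnerHypothesisOfDiscr.lean`) -/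

/-- **Row `240930b1` in closing currency with BOTH Manin binders discharged BY NAME** (o5-r2 GEN 33 docket (iii); GEN 35: Mazur on the
companion side, A321 flags carried on the record side).
RECORD side — `hc3 : ¬ 3 ∣ c(D)` (record `240930b1`, additive at `3`: `N = N(240930b1) = 240930 = 2·3²·5·2677`, `3² ∣ N`, so Mazur 1978 Cor. 4.1 does NOT apply) is
REPLACED by the named fact `hMan` = `cremona_abs_maninConstant_eq_one_of_level_le_300000` (lit GEN 112, p368272, `Literature/…/
ManinConstantConductorLe300000.lean`: Cremona's completed verification `|c| = 1` for every optimal curve of conductor `≤ 300000`, as cited in print by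
Česnavičius–Neururer–Saha, JEMS 26 (2024) §1; corollary `not_dvd_maninConstant_of_level_le_300000`) + the optimality `hopt` of the chosen datum
(`Λ_E ⊆ c·Λ_f`, the fact's own binder), the bound `N ≤ 300000` by Carayol's level theorem (from `hmod`) + the kernel numeral `conductorNorm_W240930b1`.
PROVENANCE FLAGS CARRIED WITH `hMan` (registry CITED-FACTS A321, tier PUB[sec]; referee A R199.5; REFEREE-2 R2-140.1 — BOTH flags travel to
every consumer row): `CRE19-db-primary` (the refereed SECONDARY sentence asserts the statement for `N ≤ 300000`; the PRIMARY is Cremona's database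
documentation `ecdata/manin.txt`, unrefereed beyond the Agashe–Ribet–Stein 2006 appendix, A54, bound `130000`) and `CNS24-range-reading` (narrowest
honest reading of the ČNS population = isogeny classes of conductor `≤ 300000` WITH an odd additive prime); usable AS PRINTED at `N ≤ 300000` ONLY.
THIS instantiation is inside the range AND the narrow population: `N = 240930 = 2·3²·5·2677 ≤ 300000`, odd additive prime `3`; it is the ONLY A321 use here.
COMPANION side — `hc3' : ¬ 3 ∣ c(D')` (good companion `26770a1`: `N' = N(26770a1) = 26770 = 2·5·2677`, `3 ∤ N'`) is REPLACED by the REFEREED theorem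
Mazur 1978, Cor. 4.1 BY NAME: `hMaz` = `mazur_not_dvd_maninConstant_of_odd` (`Literature/NumberTheory/EllipticCurves/
ManinConstantSemistablePrimewise.lean`, librarian 2026-08-16, BUILT; = (MK-1) of Česnavičius 2018 Thm. 1.2, arXiv:1604.02165 p. 3: "for a new elliptic
optimal quotient `π : J₀(n) ↠ E` and a prime `p`, if `ord_p(n) ≤ 1` then `ord_p(c_π) = 0` … (MK-1) if `p` is odd (Mazur, [Maz78] Cor. 4.1)";
consumed the same way by X11b `BDPRouteManin`)
+ the optimality `hopt'` of the chosen companion datum: globally minimal `26770a1` (instance, 25c MODELS `…TwoSidedRow240930b1Models` l.191), `p = 3 ≠ 2` (`decide`),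
`¬ 3² ∣ N'` by Carayol (`N' = 26770`, kernel numeral `conductorNorm_G26770a1`) + `norm_num` — no range bound, no database primary, NO flag.
NO Manin binder remains on this row. The binder `hW20` (Wuthrich 2014, Lemma 20) of `o5_bsdp_row240930b1` is discharged BY NAME
(`Wuthrich2014.lemma20_surjective_threeAdic_of_semistable_holds`, tree, 2026-08-21) and `hmodE` is DERIVED from `hmod`
(`hasEntireLFunction_rat_of_exists_isNewformOf`); the Heegner hypotheses `hH`, `hH'`, `h3K` are DERIVED in the kernel
(`satisfiesHeegnerHypothesis_240930_of_discr` of part 35h `O5/HeegnerHypothesisOfDiscr.lean` + Carayol + `of_dvd`). Everything else exactly as `o5_bsdp_row240930b1`.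
Conditional theorem; research route; O5 OPEN; nothing booked; census rows = EVIDENCE.
[cite: CesnaviciusNeururerSaha2023, §1 (arXiv:1911.09446v3 text chunk 3 L70-72)] [cite: AgasheRibetStein2006, Thm. 2.6]
[cite: Mazur1978, Cor. 4.1] [cite: Cesnavicius2018, Thm. 1.2 (MK-1) (arXiv:1604.02165 text chunk 3 L49-59)]
[cite: DiamondShurman2005, Thm. 8.8.1] [cite: Wuthrich2014, Lemma 20 (p. 399)] -/
theorem o5_bsdp_row240930b1_manin
    (hKL : KrizLi2019.thm116_padicLogHeegner_congruence)
    (hYZ : YanZhu2026.thm415_padicValRat_bsd_rank_le_one)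
    (hmod : exists_isNewformOf)
    (hGZK : rank_eq_analyticRank_of_analyticRank_le_one)
    (hρ : W240930b1.HasSurjectiveModNGaloisRep 3) (hr : W240930b1.analyticRank = 1)
    {N N' : ℕ} [NeZero N] [NeZero N'] (D : ModularParametrizationData W240930b1 N)
    (D' : ModularParametrizationData G26770a1 N')
    (K : Type) [Field K] [NumberField K] (hK : IsImaginaryQuadratic K) (hdK : NumberField.discr K = -551)
    (hGZ : gross_zagier N W240930b1 K) (hKo : kolyvagin N W240930b1 K)
    (hB : Kolyvagin1990_padicValNat_card_sha_le N W240930b1 K)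
    (hKoG : kolyvagin N' G26770a1 K) (hGZG : gross_zagier N' G26770a1 K)
    (H : HeegnerDatum N (NumberField.discr K)) (H' : HeegnerDatum N' (NumberField.discr K))
    (ι : K →+* ℂ) (ι₃ : K →+* ℚ_[3])
    (P : (W240930b1.baseChange K).toAffine.Point) (P' : (G26770a1.baseChange K).toAffine.Point)
    (hP : WeierstrassCurve.Affine.Point.map ι.toRatAlgHom P = heegnerPointComplex D H)
    (hP' : WeierstrassCurve.Affine.Point.map ι.toRatAlgHom P' = heegnerPointComplex D' H')
    (hP'inf : ¬ IsOfFinAddOrder P')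
    (hSelG : Nat.card (G26770a1.selmerGroup (3 : ℤ)) = 3 ^ G26770a1.mordellWeilRank)
    (hSelGd : Nat.card (Gd551.selmerGroup (3 : ℤ)) = 3 ^ Gd551.mordellWeilRank)
    (hMan : cremona_abs_maninConstant_eq_one_of_level_le_300000)
    (hMaz : mazur_not_dvd_maninConstant_of_odd)
    (hopt : ∀ z ∈ D.L.lattice, ∃ w ∈ periodLattice D.f, z = D.c * w)
    (hopt' : ∀ z ∈ D'.L.lattice, ∃ w ∈ periodLattice D'.f, z = D'.c * w)
    (qd : ℚ) (hqd : Wd240930b1_551.entireLFunction 1 / (Wd240930b1_551.realPeriodRat : ℂ) = (qd : ℂ))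
    (hqd0 : qd ≠ 0) (hvd : padicValRat 3 qd = 0) :
    BSDp W240930b1 3 :=
  have hN : N = 240930 :=
    (IsNewformOf.level_eq_conductorNorm_of_exists_isNewformOf hmod D.isNewformOf).trans conductorNorm_W240930b1
  have hN' : N' = 26770 :=
    (IsNewformOf.level_eq_conductorNorm_of_exists_isNewformOf hmod D'.isNewformOf).trans conductorNorm_G26770a1
  have hHK : SatisfiesHeegnerHypothesis 240930 K := satisfiesHeegnerHypothesis_240930_of_discr hK.1 hdK
  o5_bsdp_row240930b1 hKL hYZ
    Wuthrich2014.lemma20_surjective_threeAdic_of_semistable_holds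
    hmod
    (hasEntireLFunction_rat_of_exists_isNewformOf hmod)
    hGZK hρ hr D D' K hK hdK
    (by rw [hN]; exact hHK) (by rw [hN']; exact hHK.of_dvd (by norm_num)) (hHK.of_dvd (by norm_num))
    hGZ hKo hB hKoG hGZG H H'
    ι ι₃ P P' hP hP' hP'inf hSelG hSelGd
    (not_dvd_maninConstant_of_level_le_300000 hMan W240930b1 D hopt (hN.le.trans (by norm_num)) Nat.prime_three)
    (hMaz G26770a1 D' hopt' 3 Nat.prime_three (by decide) (by rw [hN']; norm_num))
    qd hqd hqd0 hvd

/-- **Row `240930b1` in closing currency with the COMPANION-side Manin binder discharged BY NAME from Mazur 1978, Cor. 4.1 — flag-free**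
(o5-r2 GEN 35): `hc3' : ¬ 3 ∣ c(D')` (good companion `26770a1`: `N' = N(26770a1) = 26770 = 2·5·2677`, `3 ∤ N'`, a fortiori `3² ∤ N'`) is REPLACED by the
REFEREED theorem Mazur 1978, Cor. 4.1 BY NAME: `hMaz` = `mazur_not_dvd_maninConstant_of_odd` (`Literature/NumberTheory/EllipticCurves/
ManinConstantSemistablePrimewise.lean`, librarian 2026-08-16, BUILT; = (MK-1) of Česnavičius 2018 Thm. 1.2, arXiv:1604.02165 p. 3: "for a new elliptic
optimal quotient `π : J₀(n) ↠ E` and a prime `p`, if `ord_p(n) ≤ 1` then `ord_p(c_π) = 0` … (MK-1) if `p` is odd (Mazur, [Maz78] Cor. 4.1)";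
consumed the same way by X11b `BDPRouteManin`)
and the optimality `hopt'` of the chosen companion datum (`Λ_E ⊆ c·Λ_f`, the fact's own binder): globally minimal `26770a1` (instance,
25c MODELS `…TwoSidedRow240930b1Models` l.191), `p = 3 ≠ 2` (`decide`), `¬ 3² ∣ N'` by Carayol's level theorem `IsNewformOf.level_eq_conductorNorm_of_exists_isNewformOf`
(from `hmod`) + the kernel numeral `conductorNorm_G26770a1` + `norm_num`. No range bound, no database primary, NO registry flag travels with this discharge.
The RECORD-side binder `hc3 : ¬ 3 ∣ c(D)` stays DISPLAYED: `N(240930b1) = 240930 = 2·3²·5·2677` has `3² ∣ N` — outside Mazur's hypothesis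
(A321 = `cremona_abs_maninConstant_eq_one_of_level_le_300000` discharges it, WITH its two provenance flags
`CRE19-db-primary` + `CNS24-range-reading`: see `o5_bsdp_row240930b1_manin`; this theorem is the flag-free variant).
The binder `hW20` (Wuthrich 2014, Lemma 20) of `o5_bsdp_row240930b1` is discharged BY NAME
(`Wuthrich2014.lemma20_surjective_threeAdic_of_semistable_holds`, tree, 2026-08-21) and `hmodE` is DERIVED from `hmod`
(`hasEntireLFunction_rat_of_exists_isNewformOf`); the Heegner hypotheses `hH`, `hH'`, `h3K` are DERIVED in the kernel
(`satisfiesHeegnerHypothesis_240930_of_discr` of part 35h `O5/HeegnerHypothesisOfDiscr.lean` + Carayol + `of_dvd`). Everything else exactly as `o5_bsdp_row240930b1`.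
Conditional theorem; research route; O5 OPEN; nothing booked; census rows = EVIDENCE.
[cite: Mazur1978, Cor. 4.1] [cite: Cesnavicius2018, Thm. 1.2 (MK-1) (arXiv:1604.02165 text chunk 3 L49-59)]
[cite: AgasheRibetStein2006, Thm. 2.3] [cite: DiamondShurman2005, Thm. 8.8.1] [cite: Wuthrich2014, Lemma 20 (p. 399)] -/
theorem o5_bsdp_row240930b1_mazur
    (hKL : KrizLi2019.thm116_padicLogHeegner_congruence)
    (hYZ : YanZhu2026.thm415_padicValRat_bsd_rank_le_one)
    (hmod : exists_isNewformOf)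
    (hGZK : rank_eq_analyticRank_of_analyticRank_le_one)
    (hρ : W240930b1.HasSurjectiveModNGaloisRep 3) (hr : W240930b1.analyticRank = 1)
    {N N' : ℕ} [NeZero N] [NeZero N'] (D : ModularParametrizationData W240930b1 N)
    (D' : ModularParametrizationData G26770a1 N')
    (K : Type) [Field K] [NumberField K] (hK : IsImaginaryQuadratic K) (hdK : NumberField.discr K = -551)
    (hGZ : gross_zagier N W240930b1 K) (hKo : kolyvagin N W240930b1 K)
    (hB : Kolyvagin1990_padicValNat_card_sha_le N W240930b1 K)
    (hKoG : kolyvagin N' G26770a1 K) (hGZG : gross_zagier N' G26770a1 K)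
    (H : HeegnerDatum N (NumberField.discr K)) (H' : HeegnerDatum N' (NumberField.discr K))
    (ι : K →+* ℂ) (ι₃ : K →+* ℚ_[3])
    (P : (W240930b1.baseChange K).toAffine.Point) (P' : (G26770a1.baseChange K).toAffine.Point)
    (hP : WeierstrassCurve.Affine.Point.map ι.toRatAlgHom P = heegnerPointComplex D H)
    (hP' : WeierstrassCurve.Affine.Point.map ι.toRatAlgHom P' = heegnerPointComplex D' H')
    (hP'inf : ¬ IsOfFinAddOrder P')
    (hSelG : Nat.card (G26770a1.selmerGroup (3 : ℤ)) = 3 ^ G26770a1.mordellWeilRank)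
    (hSelGd : Nat.card (Gd551.selmerGroup (3 : ℤ)) = 3 ^ Gd551.mordellWeilRank)
    (hMaz : mazur_not_dvd_maninConstant_of_odd)
    (hc3 : ¬ ((3 : ℤ) ∣ D.maninConstant))
    (hopt' : ∀ z ∈ D'.L.lattice, ∃ w ∈ periodLattice D'.f, z = D'.c * w)
    (qd : ℚ) (hqd : Wd240930b1_551.entireLFunction 1 / (Wd240930b1_551.realPeriodRat : ℂ) = (qd : ℂ))
    (hqd0 : qd ≠ 0) (hvd : padicValRat 3 qd = 0) :
    BSDp W240930b1 3 :=
  have hN : N = 240930 :=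
    (IsNewformOf.level_eq_conductorNorm_of_exists_isNewformOf hmod D.isNewformOf).trans conductorNorm_W240930b1
  have hN' : N' = 26770 :=
    (IsNewformOf.level_eq_conductorNorm_of_exists_isNewformOf hmod D'.isNewformOf).trans conductorNorm_G26770a1
  have hHK : SatisfiesHeegnerHypothesis 240930 K := satisfiesHeegnerHypothesis_240930_of_discr hK.1 hdK
  o5_bsdp_row240930b1 hKL hYZ
    Wuthrich2014.lemma20_surjective_threeAdic_of_semistable_holds
    hmod
    (hasEntireLFunction_rat_of_exists_isNewformOf hmod)
    hGZK hρ hr D D' K hK hdK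
    (by rw [hN]; exact hHK) (by rw [hN']; exact hHK.of_dvd (by norm_num)) (hHK.of_dvd (by norm_num))
    hGZ hKo hB hKoG hGZG H H'
    ι ι₃ P P' hP hP' hP'inf hSelG hSelGd
    hc3
    (hMaz G26770a1 D' hopt' 3 Nat.prime_three (by decide) (by rw [hN']; norm_num))
    qd hqd hqd0 hvd

end Summit.BirchSwinnertonDyer.Rank1Residual.O5.HeegnerLogTransport

end
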